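import Mathlib
import HarnessLib

/-!
# The unitary group is Zariski dense in all matrices (algebraic half of Weyl's unitarian trick)

A complex polynomial in the `n²` matrix entries which vanishes on the unitary group `U(n)`
vanishes identically (`Literature.RepresentationTheory.AlgebraicGroups.mvPolynomial_eq_zero_of_eval_unitaryGroup`).
This is the algebraic input of Weyl's "unitarian trick": a polynomial identity between matrix
functions that holds on the compact form `U(n)` holds on all of `M_n(ℂ) ⊇ GL_n(ℂ)`; it is used in
`MumfordSeparation` to pass from `SU(n)`-invariance (obtained by Haar averaging) to
`SL_n(ℂ)`-invariance of polynomial invariants of forms.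

Proof (elementary, avoiding Lie theory and the exponential map):
* the torus `(S¹)^n` is Zariski dense in `ℂⁿ` (a polynomial vanishing on a product of infinite
  sets vanishes — Mathlib's `MvPolynomial.eq_zero_of_eval_zero_at_prod_finset` with large finite
  sets of roots of unity), so vanishing on `U(n)` gives vanishing on `u · diag(t) · u'` for all
  unitary `u, u'` and all `t ∈ ℂⁿ`;
* by the spectral theorem (`Matrix.IsHermitian.spectral_theorem`) every Hermitian matrix is of
  that form, with `t` real;
* Hermitian matrices are a real form of `M_n(ℂ)`: for `H₁, H₂` Hermitian the one-variable
  polynomial `z ↦ P(H₁ + z H₂)` vanishes on `ℝ`, hence identically, and every matrix is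
  `H₁ + i H₂`.

References: H. Weyl, *The Classical Groups* (1939), Ch. VIII §11 ("unitarian trick");
R. Goodman, N. R. Wallach, *Symmetry, Representations, and Invariants*, GTM 255 (2009),
Thm. 11.5.10 (a compact real form `U` of a connected reductive group `G` is Zariski dense in `G`;
here `G = GL(n, ℂ)`, `U = U(n)`, `θ = id`) and §3.3.4 (the unitarian trick). All statements here
are proved; nothing is vendored as a named fact.
-/

open MvPolynomial Matrix

namespace Literature.RepresentationTheory.AlgebraicGroups

noncomputable section

variable {n : Type*} [Fintype n] [DecidableEq n]

/-- **The compact torus is Zariski dense in affine space**: a complex polynomial in finitely many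
variables which vanishes at every point all of whose coordinates have modulus `1` is the zero
polynomial. (Each coordinate ranges over the infinite set `S¹`; we use Mathlib's
`MvPolynomial.eq_zero_of_eval_zero_at_prod_finset` with the `N`-th roots of unity, `N` larger
than the degree.) [folklore] -/
theorem mvPolynomial_eq_zero_of_eval_torus {ι : Type*} [Finite ι] (P : MvPolynomial ι ℂ)
    (h : ∀ t : ι → ℂ, (∀ i, ‖t i‖ = 1) → eval t P = 0) : P = 0 := by
  classical
  set N := P.totalDegree + 1 with hN_def
  have hN : 0 < N := Nat.succ_pos _
  refine eq_zero_of_eval_zero_at_prod_finset P (fun _ => Polynomial.nthRootsFinset N (1 : ℂ))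
    (fun i => ?_) (fun x hx => h x fun i => ?_)
  · rw [(Complex.isPrimitiveRoot_exp N hN.ne').card_nthRootsFinset]
    exact Nat.lt_succ_of_le (degreeOf_le_totalDegree P i)
  · exact Complex.norm_eq_one_of_pow_eq_one
      ((Polynomial.mem_nthRootsFinset hN (1 : ℂ)).1 (hx i)) hN.ne'

/-- A diagonal matrix with entries of modulus `1` is unitary. [folklore] -/
theorem diagonal_mem_unitaryGroup_of_norm_eq_one {t : n → ℂ} (ht : ∀ i, ‖t i‖ = 1) :
    diagonal t ∈ Matrix.unitaryGroup n ℂ := by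
  rw [Matrix.mem_unitaryGroup_iff, star_eq_conjTranspose, diagonal_conjTranspose,
    diagonal_mul_diagonal, ← diagonal_one]
  congr 1
  funext i
  have : (t i) * (starRingEnd ℂ) (t i) = 1 := by
    rw [Complex.mul_conj, Complex.normSq_eq_norm_sq, ht i]; simp
  simpa using this

/-- Torus saturation: if a polynomial in the matrix entries vanishes on `U(n)`, then it vanishes
at `u · diag(t) · u'` for all unitary `u, u'` and **every** `t ∈ ℂⁿ` (not only `|tᵢ| = 1`),
because `t ↦ P(u · diag(t) · u')` is a polynomial vanishing on the torus. [folklore] -/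
theorem eval_unitary_mul_diagonal_mul_unitary_eq_zero (P : MvPolynomial (n × n) ℂ)
    (hP : ∀ U : Matrix n n ℂ, U ∈ Matrix.unitaryGroup n ℂ → eval (fun p => U p.1 p.2) P = 0)
    {u u' : Matrix n n ℂ} (hu : u ∈ Matrix.unitaryGroup n ℂ) (hu' : u' ∈ Matrix.unitaryGroup n ℂ)
    (t : n → ℂ) : eval (fun p => (u * diagonal t * u') p.1 p.2) P = 0 := by
  set Q : MvPolynomial n ℂ :=
    aeval (fun p : n × n => ∑ k, C (u p.1 k) * X k * C (u' k p.2)) P with hQ_def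
  have hQ : ∀ s : n → ℂ, eval s Q = eval (fun p => (u * diagonal s * u') p.1 p.2) P := by
    intro s
    have hc : (eval s).comp (algebraMap ℂ (MvPolynomial n ℂ)) = RingHom.id ℂ :=
      eval₂Hom_comp_C _ _
    rw [hQ_def, map_aeval, hc]
    have hfg : (fun p : n × n => eval s (∑ k, C (u p.1 k) * X k * C (u' k p.2))) =
        fun p => (u * diagonal s * u') p.1 p.2 := by
      funext p
      rw [Matrix.mul_apply]
      simp only [Matrix.mul_diagonal, map_sum, map_mul, eval_C, eval_X]
    exact congrArg (fun f => eval f P) hfg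
  have hQ0 : Q = 0 := by
    refine mvPolynomial_eq_zero_of_eval_torus Q fun s hs => ?_
    rw [hQ s]
    exact hP _ (mul_mem (mul_mem hu (diagonal_mem_unitaryGroup_of_norm_eq_one hs)) hu')
  have := hQ t
  rwa [hQ0, map_zero, eq_comm] at this

/-- If a polynomial in the matrix entries vanishes on `U(n)`, it vanishes at every Hermitian
matrix (spectral theorem: `H = u · diag(λ) · u⋆` with `u` unitary and `λ` real, then torus
saturation). [folklore] -/
theorem eval_eq_zero_of_isHermitian (P : MvPolynomial (n × n) ℂ)
    (hP : ∀ U : Matrix n n ℂ, U ∈ Matrix.unitaryGroup n ℂ → eval (fun p => U p.1 p.2) P = 0)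
    {H : Matrix n n ℂ} (hH : H.IsHermitian) : eval (fun p => H p.1 p.2) P = 0 := by
  have key := eval_unitary_mul_diagonal_mul_unitary_eq_zero P hP hH.eigenvectorUnitary.2
    (Unitary.star_mem hH.eigenvectorUnitary.2) (RCLike.ofReal ∘ hH.eigenvalues)
  have hspec := hH.spectral_theorem
  rw [Unitary.conjStarAlgAut_apply] at hspec
  rw [hspec]
  exact key

omit [Fintype n] [DecidableEq n] in
/-- **Hermitian matrices are a real form of `M_n(ℂ)`**: a complex polynomial in the matrix
entries vanishing at every Hermitian matrix is zero. For Hermitian `H₁, H₂` the polynomial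
`z ↦ P(H₁ + z H₂)` vanishes for real `z`, hence identically, and every matrix is `H₁ + i H₂`
with `H₁ = (M + Mᴴ)/2`, `H₂ = (M - Mᴴ)/(2i)`. [folklore] -/
theorem mvPolynomial_eq_zero_of_eval_isHermitian (P : MvPolynomial (n × n) ℂ)
    (hP : ∀ H : Matrix n n ℂ, H.IsHermitian → eval (fun p => H p.1 p.2) P = 0) : P = 0 := by
  apply MvPolynomial.funext
  intro x
  rw [map_zero]
  set M : Matrix n n ℂ := Matrix.of fun i j => x (i, j) with hM_def
  set H₁ : Matrix n n ℂ := (2 : ℂ)⁻¹ • (M + Mᴴ) with hH₁_def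
  set H₂ : Matrix n n ℂ := ((2 : ℂ)⁻¹ * -Complex.I) • (M - Mᴴ) with hH₂_def
  have h₁ : H₁.IsHermitian := by
    refine Matrix.IsHermitian.ext fun i j => ?_
    simp only [hH₁_def, Matrix.smul_apply, Matrix.add_apply, Matrix.conjTranspose_apply,
      smul_eq_mul, Complex.star_def, map_mul, map_add, map_inv₀, map_ofNat, Complex.conj_conj]
    ring
  have h₂ : H₂.IsHermitian := by
    refine Matrix.IsHermitian.ext fun i j => ?_
    simp only [hH₂_def, Matrix.smul_apply, Matrix.sub_apply, Matrix.conjTranspose_apply,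
      smul_eq_mul, Complex.star_def, map_mul, map_sub, map_neg, map_inv₀, map_ofNat,
      Complex.conj_conj, Complex.conj_I]
    ring
  have hdec : H₁ + Complex.I • H₂ = M := by
    ext i j
    simp only [hH₁_def, hH₂_def, Matrix.add_apply, Matrix.smul_apply, Matrix.sub_apply,
      smul_eq_mul]
    linear_combination (-(2 : ℂ)⁻¹ * (M i j - Mᴴ i j)) * Complex.I_mul_I
  -- the one-variable polynomial `z ↦ P(H₁ + z H₂)`
  set q : Polynomial ℂ :=
    aeval (fun p : n × n => Polynomial.C (H₁ p.1 p.2) + Polynomial.X * Polynomial.C (H₂ p.1 p.2)) P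
    with hq_def
  have hq : ∀ z : ℂ, q.eval z = eval (fun p => (H₁ + z • H₂) p.1 p.2) P := by
    intro z
    have hc : (Polynomial.evalRingHom z).comp (algebraMap ℂ (Polynomial ℂ)) = RingHom.id ℂ := by
      ext c
      simp
    rw [hq_def, ← Polynomial.coe_evalRingHom, map_aeval, hc]
    have hfg : (fun p : n × n => Polynomial.evalRingHom z
        (Polynomial.C (H₁ p.1 p.2) + Polynomial.X * Polynomial.C (H₂ p.1 p.2))) =
        fun p => (H₁ + z • H₂) p.1 p.2 := by
      funext p
      simp only [map_add, map_mul, Polynomial.coe_evalRingHom, Polynomial.eval_C,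
        Polynomial.eval_X, Matrix.add_apply, Matrix.smul_apply, smul_eq_mul]
    exact congrArg (fun f => eval f P) hfg
  have hq0 : q = 0 := by
    refine Polynomial.eq_zero_of_infinite_isRoot q (Set.Infinite.mono ?_
      (Set.infinite_range_of_injective Complex.ofReal_injective))
    rintro _ ⟨r, rfl⟩
    rw [Set.mem_setOf_eq, Polynomial.IsRoot.def, hq]
    refine hP _ (h₁.add (h₂.smul ?_))
    exact Complex.conj_ofReal r
  have hI := hq Complex.I
  rw [hq0, Polynomial.eval_zero] at hI
  have hx : (fun p : n × n => M p.1 p.2) = x := by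
    funext p
    simp [hM_def]
  rw [← hx, ← hdec]
  exact hI.symm

/-- **`U(n)` is Zariski dense in `M_n(ℂ)`** (algebraic half of Weyl's unitarian trick): a complex
polynomial in the `n²` matrix entries vanishing on the unitary group is the zero polynomial.
Goodman–Wallach, GTM 255, Thm. 11.5.10 with `G = GL(n, ℂ)`, `U = U(n)`, `θ = id` (a compact real
form is Zariski dense), combined with density of `GL(n, ℂ)` in `M_n(ℂ)`; Weyl 1939 Ch. VIII §11.
[cite: GoodmanWallachGTM255, Thm. 11.5.10] -/
theorem mvPolynomial_eq_zero_of_eval_unitaryGroup (P : MvPolynomial (n × n) ℂ)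
    (hP : ∀ U : Matrix n n ℂ, U ∈ Matrix.unitaryGroup n ℂ → eval (fun p => U p.1 p.2) P = 0) :
    P = 0 :=
  mvPolynomial_eq_zero_of_eval_isHermitian P fun _ hH => eval_eq_zero_of_isHermitian P hP hH

/-- Polynomial identities transfer from `U(n)` to all matrices: two polynomials in the matrix
entries which agree on the unitary group agree at every complex matrix. [folklore] -/
theorem eval_eq_of_eval_eq_on_unitaryGroup (P Q : MvPolynomial (n × n) ℂ)
    (h : ∀ U : Matrix n n ℂ, U ∈ Matrix.unitaryGroup n ℂ →
      eval (fun p => U p.1 p.2) P = eval (fun p => U p.1 p.2) Q)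
    (A : Matrix n n ℂ) : eval (fun p => A p.1 p.2) P = eval (fun p => A p.1 p.2) Q := by
  have hPQ : P - Q = 0 :=
    mvPolynomial_eq_zero_of_eval_unitaryGroup (P - Q) fun U hU => by rw [map_sub, h U hU, sub_self]
  rw [← sub_eq_zero, ← map_sub, hPQ, map_zero]

end

end Literature.RepresentationTheory.AlgebraicGroups
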